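import Summits.BirchSwinnertonDyer.Rank1Residual.GaloisImage.CyclotomicLevelGenerators
import HarnessLib

/-!
# Generators `σ_ℓ` of the cyclotomic levels over `ℚ` CHOSEN IN THE INERTIA GROUPS, with
# prescribed cyclotomic characters (cell `b2b-bsdres`, team n1011, seat p11 GEN 9; row T-DER,
# input `hσI` of THEOREM C `Derivative.Rat.apply_sigma_eq_aeval_apply_of_eulerSystem`)

HONEST FRAMING (cell `b2b-bsdres`, run/shared/lean/b2b/bsd-rank1-residual/, verbatim in every
file): the goal of the cell is to DELETE the COMBINATION-SHAPED residual classes of the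
Birch–Swinnerton-Dyer formula for ALL analytic-rank `≤ 1` elliptic curves over `ℚ` — "full BSD
formula for every rank `≤ 1` curve in class `C`" assembled STRICTLY from published theorems — so
that the rank-`≤ 1` remainder becomes exactly the CONSTRUCTION-SHAPED classes, which are TYPED
(missing-input `Prop`s), NOT attempted. This is not "finishing BSD". Team n1011: research route on
the CONSTRUCTION-SHAPED class X4 / §I N11; TOOL theorem of Galois theory only (p-free,
curve-free); no definition, no named fact, nothing booked.

## What

Kim (*The structure of Selmer groups…*, §2.2.2): "Our convention of Kolyvagin systems depends on
the choice of generators of `Gal(ℚ(μ_ℓ)/ℚ)` for each prime `ℓ` … it corresponds to the choice of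
the primitive roots"; Rubin, *Euler systems and Kolyvagin systems* (PCMI 2011), Def. 1.9.4 /
Def. 1.9.6: the transverse comparison is read on an INERTIA element restricting to the fixed
generator `σ_L` of `Gal(ℚ_ℓ(μ_ℓ)/ℚ_ℓ)`.  THEOREM C of row T-DER evaluates the derivative cocycle
AT the generator `σ_q` and needs `σ_q` in the inertia group `I_𝔔` of a prime `𝔔 ∣ q` of `ℤ̄`
(`hσI`).  This file shows that such a choice costs nothing:

`Rat.exists_sigma_mem_inertia` — given, for every finite place `ℓ` of `ℚ` (prime `ℓ′`), a prime
`𝔔_ℓ ∣ ℓ` of `ℤ̄` and a unit `η_ℓ ∈ (ℤ/ℓ′)ˣ`, there are `σ_ℓ ∈ I_{𝔔_ℓ} ≤ Γ_ℚ` with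
`χ_{ℓ′}(σ_ℓ) = η_ℓ` (tree `exists_mem_inertia_modNCyclotomicCharacter_eq`: `χ_{ℓ′}(I_𝔔) =
(ℤ/ℓ′)ˣ`, `ℚ(μ_{ℓ′})/ℚ` totally ramified at `ℓ′`); every such `σ_ℓ` fixes the roots of unity of
order prime to `ℓ′` (`χ_m(I_𝔔) = 1` for `ℓ′ ∤ m`, tree
`modNCyclotomicCharacter_eq_one_of_mem_inertia`),
so lies in every tame level `Gal(ℚ̄/ℚ(μ_{q′}))`, `q ≠ ℓ`, and every `p`-level `Gal(ℚ̄/ℚ(μ_{p^n}))`,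
`ℓ′ ≠ p`, of `cyclotomicLevelsRat p S`; and when `η_ℓ` GENERATES `(ℤ/ℓ′)ˣ` the powers `σ_ℓ^j`,
`j < ℓ′ − 1`, represent `Γ_ℚ / Gal(ℚ̄/ℚ(μ_{ℓ′}))` exactly once each (T-DER-INST
`existsUnique_pow_inv_mul_mem_rootsOfUnityFixer`) — ROW T-DER's binder shapes `hσ`, `hcov`,
`hinj`, now together with `hσI`.

References (context): K. Rubin, PCMI 18 (2011), Def. 1.9.4, Def. 1.9.6; C.-H. Kim,
arXiv:2203.12159, §2.2.2; J. Neukirch, *Algebraic Number Theory*, Ch. I (10.3)–(10.4).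
-/

noncomputable section

open Field IsDedekindDomain
open scoped NumberField

namespace Summit.BirchSwinnertonDyer.Rank1Residual.GaloisImage.CyclotomicLevel

open Literature.NumberTheory.GaloisRepresentations

namespace Rat

open Rat.HeightOneSpectrum

/-- **An inertia element with prescribed mod-`ℓ′` cyclotomic character.**  For a finite place `ℓ`
of `ℚ` (prime `ℓ′`), a prime `𝔔 ∣ ℓ` of `ℤ̄` and `a ∈ (ℤ/ℓ′)ˣ` there is `τ ∈ I_𝔔 ≤ Γ_ℚ` with
`χ_{ℓ′}(τ) = a` (`ℚ(μ_{ℓ′})/ℚ` is totally ramified at `ℓ′`; the case `m = ℓ′`, `d = 1` of the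
tree's `exists_mem_inertia_modNCyclotomicCharacter_eq`). [folklore] -/
theorem exists_mem_inertia_modNCyclotomicCharacter_eq_of_mem_primesAbove
    (ℓ : HeightOneSpectrum (𝓞 ℚ)) {𝔔 : Ideal (absIntegers (𝓞 ℚ) ℚ)} (h𝔔 : 𝔔 ∈ ℓ.primesAbove)
    (a : (ZMod ((primesEquiv ℓ : Nat.Primes) : ℕ))ˣ) :
    haveI : NeZero ((primesEquiv ℓ : Nat.Primes) : ℕ) := ⟨(primesEquiv ℓ).2.ne_zero⟩
    ∃ τ ∈ 𝔔.inertia (absoluteGaloisGroup ℚ),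
      modNCyclotomicCharacter ℚ ((primesEquiv ℓ : Nat.Primes) : ℕ) τ = a := by
  haveI : Fact ((primesEquiv ℓ : Nat.Primes) : ℕ).Prime := ⟨(primesEquiv ℓ).2⟩
  have hm : ((primesEquiv ℓ : Nat.Primes) : ℕ) =
      ((primesEquiv ℓ : Nat.Primes) : ℕ) ^ (0 + 1) * 1 := by rw [zero_add, pow_one, mul_one]
  have ha : ZMod.unitsMap (Dvd.intro_left _ hm.symm) a = 1 := Subsingleton.elim _ _
  exact exists_mem_inertia_modNCyclotomicCharacter_eq (v := ℓ) hm (primesEquiv ℓ).2.not_dvd_one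
    rfl h𝔔 ha

/-- **Inertia elements at `ℓ` fix the roots of unity of order prime to `ℓ′`**: for `𝔔 ∣ ℓ`,
`τ ∈ I_𝔔` and `ℓ′ ∤ m`, `τ ∈ Gal(ℚ̄/ℚ(μ_m))` (`χ_m` is unramified outside `m`). [folklore] -/
theorem mem_rootsOfUnityFixer_of_mem_inertia (ℓ : HeightOneSpectrum (𝓞 ℚ))
    {𝔔 : Ideal (absIntegers (𝓞 ℚ) ℚ)} (h𝔔 : 𝔔 ∈ ℓ.primesAbove) {τ : absoluteGaloisGroup ℚ}
    (hτ : τ ∈ 𝔔.inertia (absoluteGaloisGroup ℚ)) {m : ℕ}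
    (hm : ¬ ((primesEquiv ℓ : Nat.Primes) : ℕ) ∣ m) : τ ∈ rootsOfUnityFixer ℚ m := by
  haveI : NeZero m := ⟨fun h => hm (h ▸ dvd_zero _)⟩
  haveI := h𝔔.1
  rw [rootsOfUnityFixer_eq_ker, MonoidHom.mem_ker]
  exact modNCyclotomicCharacter_eq_one_of_mem_inertia
    (Rat.natCast_not_mem_of_mem_primesAbove_of_not_dvd h𝔔 hm) hτ

/-- **Inertia elements at `ℓ` lie in the tame levels of the other places**: for `𝔔 ∣ ℓ`,
`τ ∈ I_𝔔` and a finite place `q ≠ ℓ`, `τ ∈ L.tameLevel q = Gal(ℚ̄/ℚ(μ_{q′}))`,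
`L = cyclotomicLevelsRat p S`. [folklore] -/
theorem mem_tameLevel_of_mem_inertia (p : ℕ) [Fact p.Prime] (S : Set (HeightOneSpectrum (𝓞 ℚ)))
    {ℓ : HeightOneSpectrum (𝓞 ℚ)} {𝔔 : Ideal (absIntegers (𝓞 ℚ) ℚ)} (h𝔔 : 𝔔 ∈ ℓ.primesAbove)
    {τ : absoluteGaloisGroup ℚ} (hτ : τ ∈ 𝔔.inertia (absoluteGaloisGroup ℚ))
    {q : HeightOneSpectrum (𝓞 ℚ)} (hqℓ : q ≠ ℓ) : τ ∈ (cyclotomicLevelsRat p S).tameLevel q := by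
  rw [cyclotomicLevelsRat_tameLevel]
  refine mem_rootsOfUnityFixer_of_mem_inertia ℓ h𝔔 hτ fun h => hqℓ ?_
  have h' := (Nat.prime_dvd_prime_iff_eq (primesEquiv ℓ).2 (primesEquiv q).2).mp h
  exact primesEquiv.injective (Subtype.ext h'.symm)

/-- **Inertia elements at `ℓ ≠ p` lie in all `p`-levels**: for `𝔔 ∣ ℓ`, `τ ∈ I_𝔔` and `ℓ′ ≠ p`,
`τ ∈ L.pLevel n = Gal(ℚ̄/ℚ(μ_{p^n}))`. [folklore] -/
theorem mem_pLevel_of_mem_inertia (p : ℕ) [Fact p.Prime] (S : Set (HeightOneSpectrum (𝓞 ℚ)))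
    {ℓ : HeightOneSpectrum (𝓞 ℚ)} {𝔔 : Ideal (absIntegers (𝓞 ℚ) ℚ)} (h𝔔 : 𝔔 ∈ ℓ.primesAbove)
    {τ : absoluteGaloisGroup ℚ} (hτ : τ ∈ 𝔔.inertia (absoluteGaloisGroup ℚ))
    (hℓp : ((primesEquiv ℓ : Nat.Primes) : ℕ) ≠ p) (n : ℕ) :
    τ ∈ (cyclotomicLevelsRat p S).pLevel n := by
  change τ ∈ rootsOfUnityFixer ℚ (p ^ n)
  refine mem_rootsOfUnityFixer_of_mem_inertia ℓ h𝔔 hτ fun h => hℓp ?_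
  exact (Nat.prime_dvd_prime_iff_eq (primesEquiv ℓ).2 (Fact.out : p.Prime)).mp
    ((primesEquiv ℓ).2.dvd_of_dvd_pow h)

/-- **Generators of the cyclotomic levels chosen in the inertia groups** (ROW T-DER's `hσ`,
`hcov`, `hinj`, `hσI` at once).  Given primes `𝔔_ℓ ∣ ℓ` of `ℤ̄` and units `η_ℓ ∈ (ℤ/ℓ′)ˣ`
GENERATING `(ℤ/ℓ′)ˣ` (primitive roots, Kim's convention) for all finite places `ℓ` of `ℚ`, there
is `σ : ℓ ↦ σ_ℓ ∈ Γ_ℚ` with: `σ_ℓ ∈ I_{𝔔_ℓ}`; `χ_{ℓ′}(σ_ℓ) = η_ℓ`; `σ_ℓ ∈ Gal(ℚ̄/ℚ(μ_m))` for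
every `m` prime to `ℓ′` — in particular `σ_ℓ ∈ L.tameLevel q` for `q ≠ ℓ` and `σ_ℓ ∈ L.pLevel n`
for `ℓ′ ≠ p`, `L = cyclotomicLevelsRat p S`; every `g ∈ Γ_ℚ` is `σ_ℓ^j · u` with `j < ℓ′ − 1`,
`u ∈ L.tameLevel ℓ`, and `j` is unique.  Rubin, *Euler Systems* §4.4 (choice of `σ_ℓ`) with
Rubin PCMI Def. 1.9.4 (inertia lift of the generator of `Gal(ℚ_ℓ(μ_ℓ)/ℚ_ℓ)`). [folklore] -/
theorem exists_sigma_mem_inertia (p : ℕ) [Fact p.Prime] (S : Set (HeightOneSpectrum (𝓞 ℚ)))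
    (𝔔 : (ℓ : HeightOneSpectrum (𝓞 ℚ)) → Ideal (absIntegers (𝓞 ℚ) ℚ))
    (h𝔔 : ∀ ℓ, 𝔔 ℓ ∈ ℓ.primesAbove)
    (η : (ℓ : HeightOneSpectrum (𝓞 ℚ)) → (ZMod ((primesEquiv ℓ : Nat.Primes) : ℕ))ˣ)
    (hη : ∀ ℓ, ∀ x : (ZMod ((primesEquiv ℓ : Nat.Primes) : ℕ))ˣ, x ∈ Subgroup.zpowers (η ℓ)) :
    ∃ σ : HeightOneSpectrum (𝓞 ℚ) → absoluteGaloisGroup ℚ,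
      (∀ ℓ, σ ℓ ∈ (𝔔 ℓ).inertia (absoluteGaloisGroup ℚ)) ∧
      (∀ ℓ, haveI : NeZero ((primesEquiv ℓ : Nat.Primes) : ℕ) := ⟨(primesEquiv ℓ).2.ne_zero⟩
        modNCyclotomicCharacter ℚ ((primesEquiv ℓ : Nat.Primes) : ℕ) (σ ℓ) = η ℓ) ∧
      (∀ ℓ (m : ℕ), ¬ ((primesEquiv ℓ : Nat.Primes) : ℕ) ∣ m → σ ℓ ∈ rootsOfUnityFixer ℚ m) ∧
      (∀ ℓ q, q ≠ ℓ → σ ℓ ∈ (cyclotomicLevelsRat p S).tameLevel q) ∧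
      (∀ ℓ (n : ℕ), ((primesEquiv ℓ : Nat.Primes) : ℕ) ≠ p →
        σ ℓ ∈ (cyclotomicLevelsRat p S).pLevel n) ∧
      (∀ ℓ (g : absoluteGaloisGroup ℚ), ∃ j < ((primesEquiv ℓ : Nat.Primes) : ℕ) - 1,
        (σ ℓ ^ j)⁻¹ * g ∈ (cyclotomicLevelsRat p S).tameLevel ℓ) ∧
      (∀ ℓ, ∀ j₁ < ((primesEquiv ℓ : Nat.Primes) : ℕ) - 1,
        ∀ j₂ < ((primesEquiv ℓ : Nat.Primes) : ℕ) - 1,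
          (σ ℓ ^ j₁)⁻¹ * σ ℓ ^ j₂ ∈ (cyclotomicLevelsRat p S).tameLevel ℓ → j₁ = j₂) := by
  choose σ hσI hσχ using fun ℓ =>
    exists_mem_inertia_modNCyclotomicCharacter_eq_of_mem_primesAbove ℓ (h𝔔 ℓ) (η ℓ)
  have hfix : ∀ ℓ (m : ℕ), ¬ ((primesEquiv ℓ : Nat.Primes) : ℕ) ∣ m →
      σ ℓ ∈ rootsOfUnityFixer ℚ m :=
    fun ℓ m hm => mem_rootsOfUnityFixer_of_mem_inertia ℓ (h𝔔 ℓ) (hσI ℓ) hm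
  have hgen : ∀ ℓ, haveI : NeZero ((primesEquiv ℓ : Nat.Primes) : ℕ) := ⟨(primesEquiv ℓ).2.ne_zero⟩
      ∀ x : (ZMod ((primesEquiv ℓ : Nat.Primes) : ℕ))ˣ, x ∈ Subgroup.zpowers
        (modNCyclotomicCharacter ℚ ((primesEquiv ℓ : Nat.Primes) : ℕ) (σ ℓ)) := by
    intro ℓ x
    rw [hσχ ℓ]
    exact hη ℓ x
  refine ⟨σ, hσI, hσχ, hfix, fun ℓ q hqℓ => ?_, fun ℓ n hℓp => ?_, fun ℓ g => ?_,
    fun ℓ j₁ hj₁ j₂ hj₂ h => ?_⟩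
  · exact mem_tameLevel_of_mem_inertia p S (h𝔔 ℓ) (hσI ℓ) hqℓ
  · exact mem_pLevel_of_mem_inertia p S (h𝔔 ℓ) (hσI ℓ) hℓp n
  · -- covering
    haveI : NeZero ((primesEquiv ℓ : Nat.Primes) : ℕ) := ⟨(primesEquiv ℓ).2.ne_zero⟩
    obtain ⟨j, ⟨hj, hju⟩, -⟩ := existsUnique_pow_inv_mul_mem_rootsOfUnityFixer (σ ℓ) (hgen ℓ) g
    rw [natCard_units_zmod_eq_sub_one (primesEquiv ℓ).2] at hj
    exact ⟨j, hj, by rw [cyclotomicLevelsRat_tameLevel]; exact hju⟩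
  · -- uniqueness of the exponent
    haveI : NeZero ((primesEquiv ℓ : Nat.Primes) : ℕ) := ⟨(primesEquiv ℓ).2.ne_zero⟩
    rw [cyclotomicLevelsRat_tameLevel] at h
    have h₂ : (σ ℓ ^ j₂)⁻¹ * σ ℓ ^ j₂ ∈ rootsOfUnityFixer ℚ ((primesEquiv ℓ : Nat.Primes) : ℕ) := by
      rw [inv_mul_cancel]; exact one_mem _
    rw [← natCard_units_zmod_eq_sub_one (primesEquiv ℓ).2] at hj₁ hj₂
    exact (existsUnique_pow_inv_mul_mem_rootsOfUnityFixer (σ ℓ) (hgen ℓ) (σ ℓ ^ j₂)).unique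
      ⟨hj₁, h⟩ ⟨hj₂, h₂⟩

end Rat

end Summit.BirchSwinnertonDyer.Rank1Residual.GaloisImage.CyclotomicLevel

end
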